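import Summits.ResolutionOfSingularities.ResolutionOfSingularities.Theorems.TowerCutWeighted

/-!
# TowerCut (T2/8) — the `Type`-valued stage invariant `ShapeData` and the exit `τ ≥ 2` at the last Σ-stage

see `Theorems/MaxContactCutTowerCut.lean` (slice T8) for the main theorem `spreadExit_holds : SpreadExit`, the mechanism and the
sources ([Hironaka1964], [CossartJannsenSaito2020], [CutkoskyBook2004] §7).  `decomp-res-lens-2` g29, node «TowerCut».
-/

open CategoryTheory AlgebraicGeometry IsLocalRing TopologicalSpace Topology
open Literature.AlgebraicGeometry.Resolution
open Summit.ResolutionOfSingularities.ResolutionOfSingularities.Theorems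
open Summit.ResolutionOfSingularities.ResolutionOfSingularities.Theorems.WeakOrderReduction
open Summit.ResolutionOfSingularities.ResolutionOfSingularities.Theorems.DeltaFaceCutClasses
open Summit.ResolutionOfSingularities.ResolutionOfSingularities.Theorems.RelativeDeltaCut
open Summit.ResolutionOfSingularities.ResolutionOfSingularities.Theorems.SpreadCut

namespace Summit.ResolutionOfSingularities.ResolutionOfSingularities.Theorems.TowerCut

/-! ## §S  THE STAGE SHAPE at a point of a Σ-stage (bundled data, `Type`-valued): regular parameters `(z, u)` with
`(u)` the exceptional stalk, `zⁿ + uᵃ φ + g ∈ J`, `g ∈ Q(na + 1)`, `J ⊆ Q(na)`, and the SIMPLE-ROOT letter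
`φ ∈ 𝔪 ⇒ (z, u, φ)` regular parameters -/

section Shape

/-- **STAGE SHAPE DATA** at a point (ring level, over the stalk `A`): see the section docstring.  DATA (a `structure`
in `Type`, not a proposition / cell). [folklore] -/
structure ShapeData {A : Type} [CommRing A] [IsLocalRing A] (J E : Ideal A) (n a : ℕ) where
  /-- the corner parameter `z` -/
  z : A
  /-- the exceptional parameter `u` -/
  u : A
  /-- the secondary (chart) equation `φ` -/
  φ : A
  /-- the tail `g` -/
  g : A
  rsop : IsRsopPart ![z, u]
  exc : E = Ideal.span {u}
  mem : z ^ n + u ^ a * φ + g ∈ J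
  tail : g ∈ qWeighted ![z, u] a n (n * a + 1)
  deep : J ≤ qWeighted ![z, u] a n (n * a)
  simple : φ ∈ maximalIdeal A → IsRsopPart ![z, u, φ]

variable {A : Type} [CommRing A] [IsLocalRing A] {J E : Ideal A} {n a : ℕ}

namespace ShapeData

/-- The frame ideal contains `u`. [folklore] -/
theorem u_mem_span (D : ShapeData J E n a) : D.u ∈ Ideal.span (Set.range ![D.z, D.u]) := Ideal.subset_span ⟨1, rfl⟩

/-- `z ∈ 𝔪`. [folklore] -/
theorem z_mem (D : ShapeData J E n a) : D.z ∈ maximalIdeal A := D.rsop.mem_maximalIdeal 0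

/-- `u ∈ 𝔪`. [folklore] -/
theorem u_mem (D : ShapeData J E n a) : D.u ∈ maximalIdeal A := D.rsop.mem_maximalIdeal 1

/-- The frame ideal `(z, u)` is prime. [folklore] -/
theorem isPrime_span (D : ShapeData J E n a) : (Ideal.span (Set.range ![D.z, D.u])).IsPrime :=
  D.rsop.isPrime_span_range

/-- `J ⊆ (z, u)` (`1 ≤ n a`). [folklore] -/
theorem le_span (D : ShapeData J E n a) (hna : 1 ≤ n * a) : J ≤ Ideal.span (Set.range ![D.z, D.u]) :=
  D.deep.trans (qWeighted_le_span _ hna)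

/-- `E ⊆ (z, u)`. [folklore] -/
theorem mem_exc_iff (D : ShapeData J E n a) {x : A} : x ∈ E ↔ x ∈ Ideal.span {D.u} :=
  SetLike.ext_iff.mp D.exc x

/-- `u ∈ E`. [folklore] -/
theorem u_mem_exc (D : ShapeData J E n a) : D.u ∈ E := D.mem_exc_iff.mpr (Ideal.mem_span_singleton_self _)

/-- `E ⊆ (z, u)`. [folklore] -/
theorem exc_le_span (D : ShapeData J E n a) : E ≤ Ideal.span (Set.range ![D.z, D.u]) := by
  intro x hx
  obtain ⟨r, rfl⟩ := Ideal.mem_span_singleton'.mp (D.mem_exc_iff.mp hx)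
  exact Ideal.mul_mem_left _ _ D.u_mem_span

/-- **`zⁿ ∈ J + (u)`**: `zⁿ(1 + z r) = f − uᵃφ − u s` with `1 + z r` a unit (`g ∈ (z^{n+1}) + (u)`). [folklore] -/
theorem z_pow_mem_sup (D : ShapeData J E n a) (ha : 1 ≤ a) : D.z ^ n ∈ J ⊔ Ideal.span {D.u} := by
  obtain ⟨g₁, hg₁, g₂, hg₂, hg⟩ := Submodule.mem_sup.mp (qWeighted_succ_le_sup D.z D.u a n D.tail)
  obtain ⟨r, hr⟩ := Ideal.mem_span_singleton'.mp hg₁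
  have hunit : IsUnit (1 + r * D.z) := by
    rw [← IsLocalRing.notMem_maximalIdeal]
    intro h
    have h1 : (1 : A) ∈ maximalIdeal A := by
      have := Ideal.sub_mem _ h (Ideal.mul_mem_left _ r D.z_mem)
      rwa [add_sub_cancel_right] at this
    exact (maximalIdeal.isMaximal A).ne_top ((Ideal.eq_top_iff_one _).mpr h1)
  have hkey : D.z ^ n * (1 + r * D.z) ∈ J ⊔ Ideal.span {D.u} := by
    have heq : D.z ^ n * (1 + r * D.z) = (D.z ^ n + D.u ^ a * D.φ + D.g) - D.u ^ a * D.φ - g₂ := by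
      rw [← hg, ← hr]; ring
    rw [heq]
    refine Ideal.sub_mem _ (Ideal.sub_mem _ (Ideal.mem_sup_left D.mem) (Ideal.mem_sup_right ?_))
      (Ideal.mem_sup_right hg₂)
    obtain ⟨a', rfl⟩ : ∃ a', a = a' + 1 := ⟨a - 1, by omega⟩
    rw [pow_succ, mul_assoc]
    exact Ideal.mul_mem_left _ _ (Ideal.mul_mem_right _ _ (Ideal.mem_span_singleton_self _))
  obtain ⟨v, hv⟩ := hunit
  have : D.z ^ n = D.z ^ n * (1 + r * D.z) * ↑v⁻¹ := by
    rw [← hv, mul_assoc, Units.mul_inv, mul_one]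
  rw [this]
  exact Ideal.mul_mem_right _ _ hkey

/-- **The Σ-stalk**: `√(J + (u)) = (z, u)` (`1 ≤ a`, `1 ≤ n`). [folklore] -/
theorem radical_sup_eq (D : ShapeData J E n a) (ha : 1 ≤ a) (hn : 1 ≤ n) :
    (J ⊔ E).radical = Ideal.span (Set.range ![D.z, D.u]) := by
  haveI := D.isPrime_span
  apply le_antisymm
  · rw [Ideal.IsPrime.radical_le_iff ‹_›]
    exact sup_le (D.le_span (Nat.one_le_iff_ne_zero.mpr (Nat.mul_ne_zero_iff.mpr ⟨by omega, by omega⟩)))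
      D.exc_le_span
  · rw [Ideal.span_le]
    rintro _ ⟨j, rfl⟩
    have hE : Ideal.span {D.u} ≤ E := fun x hx => D.mem_exc_iff.mpr hx
    fin_cases j
    · exact ⟨n, sup_le_sup_left hE J (D.z_pow_mem_sup ha)⟩
    · exact Ideal.le_radical (Ideal.mem_sup_right D.u_mem_exc)

/-- **`J ⊆ 𝔪ⁿ`** at a Σ-stage (`n ≤ a`): `Q(na) ⊆ (z,u)ⁿ ⊆ 𝔪ⁿ`. [folklore] -/
theorem le_maximalIdeal_pow (D : ShapeData J E n a) (hna : n ≤ a) (ha : 0 < a) :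
    J ≤ maximalIdeal A ^ n :=
  (D.deep.trans (qWeighted_le_pow _ hna ha le_rfl)).trans
    (Ideal.pow_right_mono D.rsop.span_range_le_maximalIdeal _)

/-- The quotient by the Σ-stalk is a regular local ring. [folklore] -/
theorem isRegularLocalRing_quotient (D : ShapeData J E n a) :
    IsRegularLocalRing (A ⧸ Ideal.span (Set.range ![D.z, D.u])) :=
  D.rsop.isRegularLocalRing_quotient

/-- **GENERIZATION**: the shape data localise to every prime `𝔮 ∋ z, u` (in particular to the stalk at a
generization lying on the exceptional divisor and on `V(J)`). [folklore] -/
theorem nonempty_mapOfLePrime (D : ShapeData J E n a) (q : Ideal A) [q.IsPrime] (hz : D.z ∈ q)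
    (hu : D.u ∈ q) (Aq : Type) [CommRing Aq] [Algebra A Aq] [IsLocalization.AtPrime Aq q] [IsLocalRing Aq] :
    Nonempty (ShapeData (J.map (algebraMap A Aq)) (E.map (algebraMap A Aq)) n a) := by
  have hrsop : IsRsopPart ![algebraMap A Aq D.z, algebraMap A Aq D.u] := by
    have h := D.rsop.map_of_le_prime q (fun i => by fin_cases i <;> assumption) Aq
    rwa [comp_vec_two] at h
  have htail : algebraMap A Aq D.g ∈ qWeighted ![algebraMap A Aq D.z, algebraMap A Aq D.u] a n (n * a + 1) := by
    have h := Ideal.mem_map_of_mem (algebraMap A Aq) D.tail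
    rwa [map_qWeighted, comp_vec_two] at h
  have hdeep : J.map (algebraMap A Aq) ≤ qWeighted ![algebraMap A Aq D.z, algebraMap A Aq D.u] a n (n * a) := by
    have h := Ideal.map_mono (f := algebraMap A Aq) D.deep
    rwa [map_qWeighted, comp_vec_two] at h
  have hsimple : algebraMap A Aq D.φ ∈ maximalIdeal Aq →
      IsRsopPart ![algebraMap A Aq D.z, algebraMap A Aq D.u, algebraMap A Aq D.φ] := fun hφ => by
    have hφq : D.φ ∈ q := (IsLocalization.AtPrime.to_map_mem_maximal_iff Aq q D.φ).mp hφ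
    have hφm : D.φ ∈ maximalIdeal A := IsLocalRing.le_maximalIdeal (Ideal.IsPrime.ne_top ‹_›) hφq
    have h := (D.simple hφm).map_of_le_prime q (fun i => by fin_cases i <;> assumption) Aq
    rwa [comp_vec_three] at h
  exact ⟨{ z := algebraMap A Aq D.z
           u := algebraMap A Aq D.u
           φ := algebraMap A Aq D.φ
           g := algebraMap A Aq D.g
           rsop := hrsop
           exc := (congrArg (Ideal.map (algebraMap A Aq)) D.exc).trans
             (by rw [Ideal.map_span, Set.image_singleton])
           mem := by simpa using Ideal.mem_map_of_mem (algebraMap A Aq) D.mem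
           tail := htail
           deep := hdeep
           simple := hsimple }⟩

end ShapeData

end Shape

/-! ## §E  THE EXIT (`a + 1 = n`): at a point of the last Σ-stage with `J ⊆ 𝔪ⁿ`, Hironaka's `τ(J, n) ≥ 2` -/

section Exit

open MvPolynomial

/-- Evaluating a linear form (re-run of the folklore computation). [folklore] -/
theorem eval_linearFormPoly' {k : Type} [Field k] {d : ℕ} (ℓ : Module.Dual k (Fin d → k)) (v : Fin d → k) :
    MvPolynomial.eval v (linearFormPoly k ℓ) = ℓ v := by
  have hv : v = ∑ i, v i • (Pi.single i 1 : Fin d → k) := by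
    ext j
    simp [Finset.sum_apply, Pi.single_apply]
  rw [linearFormPoly, map_sum]
  conv_rhs => rw [hv, map_sum]
  refine Finset.sum_congr rfl fun i _ => ?_
  rw [map_mul, eval_C, eval_X, map_smul, smul_eq_mul, mul_comm]

/-- **The exit form has `τ ≥ 2`** [KERNEL, field level]: for distinct indices `i₀, i₁, i₂` and a form `H` in the two
variables `i₀, i₁` only, `G = X_{i₀}ⁿ + X_{i₁}ᵃ X_{i₂} + X_{i₁}·H` (`a + 1 = n ≥ 2`) is neither constant nor `c·ℓⁿ`:
evaluate at `e_{i₀}` (value `1`), `e_{i₂}` (value `0`, so `ℓ_{i₂} = 0`), and at `e_{i₁}`, `e_{i₁} + e_{i₂}` (values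
differing by `1`, equal for `c·ℓⁿ`). [folklore] -/
theorem two_le_hironakaTau_exitForm (k : Type) [Field k] {d : ℕ} (i₀ i₁ i₂ : Fin d) (h01 : i₀ ≠ i₁)
    (h02 : i₀ ≠ i₂) (h12 : i₁ ≠ i₂) {n a : ℕ} (han : a + 1 = n) (hn : 2 ≤ n)
    (H : MvPolynomial (Fin 2) k) (G : MvPolynomial (Fin d) k)
    (hG : G = X i₀ ^ n + X i₁ ^ a * X i₂ + X i₁ * rename ![i₀, i₁] H) (hGh : G.IsHomogeneous n) :
    2 ≤ hironakaTau k ({G} : Set (MvPolynomial (Fin d) k)) := by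
  have ha : 1 ≤ a := by omega
  -- the four evaluations
  have ev : ∀ v : Fin d → k, MvPolynomial.eval v G =
      v i₀ ^ n + v i₁ ^ a * v i₂ + v i₁ * MvPolynomial.eval (fun t => v (![i₀, i₁] t)) H := fun v => by
    rw [hG]
    simp only [map_add, map_mul, map_pow, eval_X, eval_rename]
    rfl
  have hn0 : n ≠ 0 := by omega
  have ha0 : a ≠ 0 := by omega
  have e0 : MvPolynomial.eval (Pi.single i₀ 1 : Fin d → k) G = 1 := by
    rw [ev]
    simp [Pi.single_eq_of_ne' h01, Pi.single_eq_of_ne' h02]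
  have e2 : MvPolynomial.eval (Pi.single i₂ 1 : Fin d → k) G = 0 := by
    rw [ev]
    simp [Pi.single_eq_of_ne h02, Pi.single_eq_of_ne h12, hn0, ha0]
  have hw : (fun t => (Pi.single i₁ 1 + Pi.single i₂ 1 : Fin d → k) (![i₀, i₁] t)) =
      fun t => (Pi.single i₁ 1 : Fin d → k) (![i₀, i₁] t) := by
    funext t
    fin_cases t
    · simp [Pi.single_eq_of_ne h01, Pi.single_eq_of_ne h02]
    · simp [Pi.single_eq_of_ne h12]
  have e12 : MvPolynomial.eval (Pi.single i₁ 1 + Pi.single i₂ 1 : Fin d → k) G =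
      1 + MvPolynomial.eval (Pi.single i₁ 1 : Fin d → k) G := by
    rw [ev, ev, hw]
    simp [Pi.single_eq_of_ne h01, Pi.single_eq_of_ne h02, Pi.single_eq_of_ne h12, Pi.single_eq_of_ne' h12, hn0]
  by_contra hlt
  rw [not_le] at hlt
  have h01' : hironakaTau k ({G} : Set (MvPolynomial (Fin d) k)) = 0 ∨
      hironakaTau k ({G} : Set (MvPolynomial (Fin d) k)) = 1 := by omega
  rcases h01' with h0 | h1
  · obtain ⟨c, hc⟩ := (hironakaTau_eq_zero_iff k _).mp h0 (Set.mem_singleton _)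
    have t0 := congrArg (MvPolynomial.eval (Pi.single i₀ 1 : Fin d → k)) hc
    have t2 := congrArg (MvPolynomial.eval (Pi.single i₂ 1 : Fin d → k)) hc
    rw [eval_C] at t0 t2
    rw [e0] at t0
    rw [e2] at t2
    exact one_ne_zero (t0.symm.trans t2)
  · obtain ⟨ℓ, -, -, hℓ⟩ := exists_forall_eq_C_mul_pow_of_hironakaTau_eq_one k h1
    obtain ⟨c, hc⟩ := hℓ G (Set.mem_singleton _) n hGh
    have evl : ∀ v : Fin d → k, MvPolynomial.eval v G = c * (ℓ v) ^ n := fun v => by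
      have h := congrArg (MvPolynomial.eval v) hc
      simpa only [map_mul, eval_C, map_pow, eval_linearFormPoly'] using h
    have t0 := evl (Pi.single i₀ 1)
    rw [e0] at t0
    have hc0 : c ≠ 0 := fun h => by rw [h, zero_mul] at t0; exact one_ne_zero t0
    have t2 := evl (Pi.single i₂ 1)
    rw [e2] at t2
    have hl2 : ℓ (Pi.single i₂ 1) = 0 := by
      rcases mul_eq_zero.mp t2.symm with h | h
      · exact absurd h hc0
      · exact (pow_eq_zero_iff hn0).mp h
    have t12 := evl (Pi.single i₁ 1 + Pi.single i₂ 1)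
    rw [e12, map_add, hl2, add_zero, ← evl] at t12
    have : (1 : k) = 0 := by
      simpa using congrArg (fun t => t - MvPolynomial.eval (Pi.single i₁ 1 : Fin d → k) G) t12
    exact one_ne_zero this

variable {A : Type} [CommRing A] [IsRegularLocalRing A] {J E : Ideal A} {n a : ℕ}

/-- A regular system of parameters is quasi-regular for `𝔪`: `x_i ^ a ∉ 𝔪 ^ (a + 1)`. [folklore] -/
theorem pow_not_mem_pow_succ_of_rsop {d : ℕ} (hd : (maximalIdeal A).spanFinrank = d)
    (x : Fin d → A) (hx : Ideal.span (Set.range x) = maximalIdeal A) (i : Fin d) (a : ℕ) :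
    x i ^ a ∉ maximalIdeal A ^ (a + 1) := by
  intro h
  have hq : IsQuasiRegular x := isQuasiRegular_rsop_comp hd x hx id Function.injective_id
  have hF := hq a (X i ^ a) (isHomogeneous_X_pow i a) (by rw [hx]; simpa using h)
  have h1 : MvPolynomial.coeff (Finsupp.single i a) (X i ^ a : MvPolynomial (Fin d) A) ∈ Ideal.span (Set.range x) :=
    MvPolynomial.mem_map_C_iff.mp hF _
  rw [MvPolynomial.coeff_X_pow, if_pos rfl, hx] at h1
  exact (maximalIdeal.isMaximal A).ne_top ((Ideal.eq_top_iff_one _).mpr h1)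

/-- **`φ ∈ 𝔪` at the last stage**: otherwise `uᵃ = φ⁻¹(f − zⁿ − g) ∈ 𝔪ⁿ = 𝔪ᵃ⁺¹`, against the quasi-regularity of
a regular system of parameters through `u`. [folklore] -/
theorem ShapeData.φ_mem_of_last (D : ShapeData J E n a) (han : a + 1 = n) (hn : 2 ≤ n)
    (hJ : J ≤ maximalIdeal A ^ n) : D.φ ∈ maximalIdeal A := by
  by_contra hφ
  have hunit : IsUnit D.φ := IsLocalRing.notMem_maximalIdeal.mp hφ
  have hP : Ideal.span (Set.range ![D.z, D.u]) ≤ maximalIdeal A := D.rsop.span_range_le_maximalIdeal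
  -- `g ∈ 𝔪ⁿ`
  have hg : D.g ∈ maximalIdeal A ^ n := by
    refine (qWeighted_last_le D.z D.u han hn).trans ?_ D.tail
    refine sup_le ?_ ((Ideal.pow_right_mono hP _).trans (Ideal.pow_le_pow_right (by omega)))
    refine (Ideal.mul_mono ((Ideal.span_singleton_le_iff_mem _).mpr D.u_mem) (Ideal.pow_right_mono hP a)).trans ?_
    rw [← pow_succ', han]
  have hua : D.u ^ a * D.φ ∈ maximalIdeal A ^ n := by
    have h : D.u ^ a * D.φ = (D.z ^ n + D.u ^ a * D.φ + D.g) - D.z ^ n - D.g := by ring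
    rw [h]
    exact Ideal.sub_mem _ (Ideal.sub_mem _ (hJ D.mem) (Ideal.pow_mem_pow D.z_mem n)) hg
  have hua' : D.u ^ a ∈ maximalIdeal A ^ (a + 1) := by
    obtain ⟨v, hv⟩ := hunit
    have : D.u ^ a = D.u ^ a * D.φ * ↑v⁻¹ := by rw [← hv, mul_assoc, Units.mul_inv, mul_one]
    rw [this, han]
    exact Ideal.mul_mem_right _ _ hua
  obtain ⟨e, x, hd, hx, hxi⟩ := D.rsop.exists_rsop
  have h1 : x (Fin.castAdd e 1) = D.u := hxi 1
  exact pow_not_mem_pow_succ_of_rsop hd x hx (Fin.castAdd e 1) a (h1 ▸ hua' |> fun h => by rwa [h1])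

/-- **THE EXIT, ring level** [KERNEL]: at the last stage (`a + 1 = n ≥ 2`, `J ⊆ 𝔪ⁿ`) Hironaka's `τ(J, n) ≥ 2`, computed
in the regular system of parameters extending `(z, u, φ)`: the initial form of `f` is `Zⁿ + Uᵃ Φ + U·H̄(Z, U)`.
[folklore] -/
theorem ShapeData.exists_two_le_hironakaTauAt (D : ShapeData J E n a) (han : a + 1 = n)
    (hn : 2 ≤ n) (hJ : J ≤ maximalIdeal A ^ n) :
    ∃ (d : ℕ) (c : Fin d → A), (maximalIdeal A).spanFinrank = d ∧ Ideal.span (Set.range c) = maximalIdeal A ∧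
      2 ≤ hironakaTauAt c J n := by
  have hφ := D.φ_mem_of_last han hn hJ
  obtain ⟨e, x, hd, hx, hxi⟩ := (D.simple hφ).exists_rsop
  refine ⟨3 + e, x, hd, hx, ?_⟩
  have hx0 : x (Fin.castAdd e 0) = D.z := hxi 0
  have hx1 : x (Fin.castAdd e 1) = D.u := hxi 1
  have hx2 : x (Fin.castAdd e 2) = D.φ := hxi 2
  have h01 : (Fin.castAdd e 0 : Fin (3 + e)) ≠ Fin.castAdd e 1 := fun h =>
    absurd (Fin.castAdd_injective 3 e h) (by decide)
  have h02 : (Fin.castAdd e 0 : Fin (3 + e)) ≠ Fin.castAdd e 2 := fun h =>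
    absurd (Fin.castAdd_injective 3 e h) (by decide)
  have h12 : (Fin.castAdd e 1 : Fin (3 + e)) ≠ Fin.castAdd e 2 := fun h =>
    absurd (Fin.castAdd_injective 3 e h) (by decide)
  have hP : Ideal.span (Set.range ![D.z, D.u]) ≤ maximalIdeal A := D.rsop.span_range_le_maximalIdeal
  -- decomposition of the tail `g = u·H(z,u) + R(x)`, `H` a binary form of degree `a`, `R` with coefficients in `𝔪`
  obtain ⟨g₁, hg₁, g₂, hg₂, hg⟩ := Submodule.mem_sup.mp (qWeighted_last_le D.z D.u han hn D.tail)
  obtain ⟨h, hh, hg₁'⟩ := Ideal.mem_span_singleton_mul.mp hg₁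
  obtain ⟨H, hHh, hHe⟩ := exists_isHomogeneous_of_mem_span_pow ![D.z, D.u] a hh
  have hg₂' : g₂ ∈ maximalIdeal A * Ideal.span (Set.range x) ^ n := by
    rw [hx, ← pow_succ']
    exact Ideal.pow_right_mono hP _ hg₂
  obtain ⟨Rm, hRh, hRm, hRe⟩ := exists_isHomogeneous_of_mem_mul_span_pow x (maximalIdeal A) n hg₂'
  -- the form `F` with `F(x) = f`
  set ι : Fin 2 → Fin (3 + e) := ![Fin.castAdd e 0, Fin.castAdd e 1] with hι
  have hxι : x ∘ ι = ![D.z, D.u] := by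
    funext t
    fin_cases t
    · exact hx0
    · exact hx1
  set F : MvPolynomial (Fin (3 + e)) A :=
    X (Fin.castAdd e 0) ^ n + X (Fin.castAdd e 1) ^ a * X (Fin.castAdd e 2) + X (Fin.castAdd e 1) * rename ι H + Rm
    with hF
  have hFe : MvPolynomial.eval x F = D.z ^ n + D.u ^ a * D.φ + D.g := by
    simp only [hF, map_add, map_mul, map_pow, eval_X, eval_rename, hxι, hHe, hRe, hx0, hx1, hx2]
    rw [← hg, ← hg₁']
    ring
  have hFh : F.IsHomogeneous n := by
    have h1 : (X (Fin.castAdd e 0) ^ n : MvPolynomial (Fin (3 + e)) A).IsHomogeneous n := isHomogeneous_X_pow _ _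
    have h2 : (X (Fin.castAdd e 1) ^ a * X (Fin.castAdd e 2) : MvPolynomial (Fin (3 + e)) A).IsHomogeneous n := by
      rw [← han]; exact (isHomogeneous_X_pow _ _).mul (isHomogeneous_X _ _)
    have h3 : (X (Fin.castAdd e 1) * rename ι H : MvPolynomial (Fin (3 + e)) A).IsHomogeneous n := by
      rw [← han, add_comm a 1]; exact (isHomogeneous_X _ _).mul hHh.rename_isHomogeneous
    exact ((h1.add h2).add h3).add hRh
  -- its initial form
  set G : MvPolynomial (Fin (3 + e)) (ResidueField A) := MvPolynomial.map (residue A) F with hGdef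
  have hGmem : G ∈ initialForms x J n :=
    (mem_initialForms_iff x).mpr ⟨F, hFh, by rw [hFe]; exact D.mem, rfl⟩
  have hRm0 : MvPolynomial.map (residue A) Rm = 0 := by
    ext m
    rw [coeff_map, coeff_zero, IsLocalRing.residue_eq_zero_iff]
    exact MvPolynomial.mem_map_C_iff.mp hRm m
  have hG : G = X (Fin.castAdd e 0) ^ n + X (Fin.castAdd e 1) ^ a * X (Fin.castAdd e 2) +
      X (Fin.castAdd e 1) * rename ι (MvPolynomial.map (residue A) H) := by
    simp only [hGdef, hF, map_add, map_mul, map_pow, map_X, map_rename, hRm0, add_zero]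
  have hGh : G.IsHomogeneous n := hFh.map _
  rw [hironakaTauAt]
  refine (two_le_hironakaTau_exitForm (ResidueField A) _ _ _ h01 h02 h12 han hn (MvPolynomial.map (residue A) H)
    G hG hGh).trans ?_
  exact Submodule.finrank_mono (directrix_mono _ (Set.singleton_subset_iff.mpr hGmem))

end Exit

end Summit.ResolutionOfSingularities.ResolutionOfSingularities.Theorems.TowerCut
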